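import Literature.Computability.Complexity.ZigZag
import Literature.Computability.Complexity.Expanderize
import Mathlib.Tactic.NormNum.Prime
import HarnessLib

/-!
# An explicit constant-degree expander family (Reingold–Vadhan–Wigderson, Thm. 3.3 / Arora–Barak, Thm. 21.19) from an algebraic base graph

"Let `H` be a `(D⁴, D, 1/5)`-graph … define `G₁ = H²`, `G_{i+1} = G_i² ⓩ H`.  **Theorem 3.3.** For every
`i`, `G_i` is a `(D^{4i}, D², 2/5)`-graph" (Reingold–Vadhan–Wigderson 2002, §3.2), which is the
construction behind Arora–Barak 2009, Thm. 21.19 ("explicit construction of expanders"), where the base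
graph is "found by brute force".  Here the base graph is ALGEBRAIC, so that everything is proved: with
`q = 631` (prime, `5/√q ≤ 1/5`) and `A = AP_q` (`AffinePlane.lean`, `λ ≤ 1/√q`),

`H₁ = (A ⊗ A) ⓩ A` (a `(q⁶, q², 2/√q + 1/q)`-graph), `H = (H₁ ⊗ H₁) ⓩ (A ⊗ A)` (a
`(q¹⁶, q⁴, ≤ 5/√q)`-graph, i.e. `(D⁴, D, ≤ 1/5)` with `D = q⁴`),

by `spectralBound_tensor` (Lemma 21.17) and `spectralBound_zigzag` (RVW Thm. 3.2); then the RVW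
recursion with `spectralBound_power`.

* `qb = 631`, `D = q⁴` (as `(q q)(q q)`), `B = (D D)²`; `RotGraph.cast` (transport along equalities of
  the size and degree expressions, `spectralBound_cast`);
* `baseH : RotGraph ((D*D)^2) D` with `spectralBound_baseH : λ ≤ 1/5`;
* `G i : RotGraph (N i) (D * D)`, `N i = B^(i+1)`, **`spectralBound_G : λ(G i) ≤ 2/5`** (RVW Thm. 3.3);
* the dense family used to expanderize: `Nx n = B^(log_B n + 1)` (`le_Nx`, `Nx_le : Nx n ≤ B n`),
  `XN n : RotGraph (Nx n) ((D*D)^3)` (the cube of `G (log_B n)`), **`spectralBound_XN : λ ≤ 1/10`**.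

## References

* O. Reingold, S. Vadhan, A. Wigderson, *Entropy waves, the zig-zag graph product, and new
  constant-degree expanders*, Ann. of Math. 155 (2002), §3.2, Thm. 3.3, §5.1.
* S. Arora, B. Barak, *Computational Complexity: A Modern Approach*, CUP 2009, Thm. 21.19.
-/

noncomputable section

namespace Literature.Computability.Complexity

open Finset Matrix

namespace Expander

namespace RotGraph

variable {n d n' d' : ℕ}

/-- Transport of a rotation graph along equalities of the size and degree expressions. [folklore] -/
def cast (G : RotGraph n d) (hn : n = n') (hd : d = d') : RotGraph n' d' := by subst hn; subst hd; exact G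

/-- Casting preserves spectral bounds. [folklore] -/
theorem spectralBound_cast (G : RotGraph n d) (hn : n = n') (hd : d = d') {lam : ℝ} (h : SpectralBound G.walkMatrix lam) :
    SpectralBound (G.cast hn hd).walkMatrix lam := by
  subst hn; subst hd; exact h

/-- Casting, on neighbours. [folklore] -/
theorem cast_nbr (G : RotGraph n d) (hn : n = n') (hd : d = d') (v : Fin n') (i : Fin d') :
    (G.cast hn hd).nbr v i = Fin.cast hn (G.nbr (Fin.cast hn.symm v) (Fin.cast hd.symm i)) := by
  subst hn; subst hd; rfl

end RotGraph

namespace Family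

open RotGraph

/-! ### The base graph -/

/-- The prime `q = 631`. [folklore] -/
def qb : ℕ := 631

/-- `631` is prime. [folklore] -/
theorem qb_prime : qb.Prime := by unfold qb; norm_num

/-- The `Fact` instance for `ZMod 631`. [folklore] -/
instance : Fact qb.Prime := ⟨qb_prime⟩

/-- The affine plane graph `A = AP_631`. [cite: ReingoldVadhanWigderson2002, §5.1] -/
def A : RotGraph (qb * qb) qb := AffinePlane.graph qb

/-- `μ = 1/√631`. [folklore] -/
def μ : ℝ := 1 / Real.sqrt qb

/-- `λ(A) ≤ μ`. [cite: ReingoldVadhanWigderson2002, §5.1] -/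
theorem spectralBound_A : SpectralBound A.walkMatrix μ := AffinePlane.spectralBound_graph qb

/-- `0 ≤ μ ≤ 1/25` (`√631 ≥ 25`). [folklore] -/
theorem μ_le : 0 ≤ μ ∧ μ ≤ 1 / 25 := by
  refine ⟨by unfold μ; positivity, ?_⟩
  unfold μ qb
  rw [one_div_le_one_div (Real.sqrt_pos.2 (by norm_num)) (by norm_num)]
  rw [show (25 : ℝ) = Real.sqrt (25 ^ 2) by rw [Real.sqrt_sq (by norm_num)]]
  exact Real.sqrt_le_sqrt (by norm_num)

/-- `q > 0`. [folklore] -/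
theorem qb_pos : 0 < qb := by unfold qb; norm_num

/-- The intermediate graph `H₁ = (A ⊗ A) ⓩ A`, a `(q⁶, q², 2μ + μ²)`-graph. [cite: ReingoldVadhanWigderson2002, §3.2 and §5] -/
def H₁ : RotGraph (qb * qb * (qb * qb) * (qb * qb)) (qb * qb) := (A.tensor A).zigzag A

/-- `λ(H₁) ≤ 2μ + μ²`. [cite: ReingoldVadhanWigderson2002, Thm. 3.2 and Lemma (tensoring)] -/
theorem spectralBound_H₁ : SpectralBound H₁.walkMatrix (μ + μ + μ ^ 2) := by
  have hT := spectralBound_tensor A A qb_pos qb_pos spectralBound_A spectralBound_A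
  rw [max_self] at hT
  exact spectralBound_zigzag _ _ (Nat.mul_pos qb_pos qb_pos) qb_pos hT spectralBound_A

/-- The degree `D = q⁴` of the base graph. [cite: ReingoldVadhanWigderson2002, §3.2 (H is a (D⁴, D, 1/5)-graph)] -/
def D : ℕ := qb * qb * (qb * qb)

/-- `D > 0`. [folklore] -/
theorem D_pos : 0 < D := by unfold D; have := qb_pos; positivity

/-- The base graph before casting: `(H₁ ⊗ H₁) ⓩ (A ⊗ A)`, on `q¹⁶` vertices with degree `D = q⁴`. [cite: ReingoldVadhanWigderson2002, §3.2 and §5] -/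
def H₂ : RotGraph (qb * qb * (qb * qb) * (qb * qb) * (qb * qb * (qb * qb) * (qb * qb)) * (qb * qb * (qb * qb))) (qb * qb * (qb * qb)) :=
  (H₁.tensor H₁).zigzag (A.tensor A)

/-- `λ(H₂) ≤ (2μ + μ²) + μ + μ² ≤ 1/5`. [cite: ReingoldVadhanWigderson2002, Thm. 3.2] -/
theorem spectralBound_H₂ : SpectralBound H₂.walkMatrix (1 / 5) := by
  have hq2 : 0 < qb * qb := Nat.mul_pos qb_pos qb_pos
  have hT := spectralBound_tensor H₁ H₁ hq2 hq2 spectralBound_H₁ spectralBound_H₁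
  rw [max_self] at hT
  have hA2 := spectralBound_tensor A A qb_pos qb_pos spectralBound_A spectralBound_A
  rw [max_self] at hA2
  have hZ := spectralBound_zigzag _ _ (Nat.mul_pos hq2 hq2) hq2 hT hA2
  refine hZ.mono ?_
  obtain ⟨h0, h1⟩ := μ_le
  nlinarith

/-- The size of `H₂` is `(D D)²`. [folklore] -/
theorem size_H₂ : qb * qb * (qb * qb) * (qb * qb) * (qb * qb * (qb * qb) * (qb * qb)) * (qb * qb * (qb * qb)) = (D * D) ^ 2 := by
  unfold D; ring

/-- **The base graph `H`**: a `((D D)², D, 1/5)`-graph, i.e. `(D⁴, D, 1/5)`. [cite: ReingoldVadhanWigderson2002, §3.2] -/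
def baseH : RotGraph ((D * D) ^ 2) D := H₂.cast size_H₂ rfl

/-- `λ(H) ≤ 1/5`. [cite: ReingoldVadhanWigderson2002, §3.2] -/
theorem spectralBound_baseH : SpectralBound baseH.walkMatrix (1 / 5) := spectralBound_cast _ _ _ spectralBound_H₂

/-! ### The recursion (RVW Thm. 3.3) -/

/-- The size ratio `B = (D D)² = D⁴`. [cite: ReingoldVadhanWigderson2002, Thm. 3.3 (D^{4i} vertices)] -/
def B : ℕ := (D * D) ^ 2

/-- `D ≥ 2`. [folklore] -/
theorem two_le_D : 2 ≤ D := by unfold D qb; norm_num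

/-- `B ≥ 2`. [folklore] -/
theorem two_le_B : 2 ≤ B := by
  unfold B
  have h := two_le_D
  calc 2 ≤ D := h
    _ ≤ D * D := Nat.le_mul_of_pos_right _ D_pos
    _ ≤ (D * D) ^ 2 := by rw [sq]; exact Nat.le_mul_of_pos_right _ (Nat.mul_pos D_pos D_pos)

/-- The sizes `N i = B^(i+1)`. [cite: ReingoldVadhanWigderson2002, Thm. 3.3] -/
def N : ℕ → ℕ
  | 0 => (D * D) ^ 2
  | i + 1 => N i * (D * D) ^ 2

/-- `N i = B^(i+1)`. [folklore] -/
theorem N_eq (i : ℕ) : N i = B ^ (i + 1) := by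
  induction i with
  | zero => simp [N, B]
  | succ i ih => rw [N, ih, B]; ring

/-- **The family `G i`** (`N i` vertices, degree `D²`): `G 0 = H²`, `G (i+1) = (G i)² ⓩ H`. [cite: ReingoldVadhanWigderson2002, §3.2 (G₁ = H², G_{i+1} = G_i² ⓩ H)] -/
def G : (i : ℕ) → RotGraph (N i) (D * D)
  | 0 => (baseH.power 2).cast rfl (sq D)
  | i + 1 => ((G i).power 2).zigzag baseH

/-- **Reingold–Vadhan–Wigderson, Theorem 3.3**: `λ(G i) ≤ 2/5` for all `i`
(`λ(H²) ≤ 1/25`, and `λ² + 1/5 + 1/25 ≤ 2/5` when `λ ≤ 2/5`). [cite: ReingoldVadhanWigderson2002, Thm. 3.3] -/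
theorem spectralBound_G : ∀ i : ℕ, SpectralBound (G i).walkMatrix (2 / 5)
  | 0 => by
    have h := spectralBound_power baseH D_pos spectralBound_baseH 2
    exact (spectralBound_cast _ rfl (sq D) h).mono (by norm_num)
  | i + 1 => by
    have hDD : 0 < D * D := Nat.mul_pos D_pos D_pos
    have hG2 := spectralBound_power (G i) hDD (spectralBound_G i) 2
    have hZ := spectralBound_zigzag _ _ (pow_pos hDD 2) D_pos hG2 spectralBound_baseH
    exact hZ.mono (by norm_num)

/-! ### The dense family of `1/10`-expanders -/

/-- The index of the family member used for `n` vertices: `log_B n`. [folklore] -/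
def idx (n : ℕ) : ℕ := Nat.log B n

/-- **The padded size** `Nx n = N (log_B n) = B^(log_B n + 1)`. [cite: AroraBarakCC2009, Thm. 21.19 (a graph for every size up to a constant factor)] -/
def Nx (n : ℕ) : ℕ := N (idx n)

/-- `n ≤ Nx n`. [folklore] -/
theorem le_Nx (n : ℕ) : n ≤ Nx n := by
  rw [Nx, N_eq, idx]
  exact (Nat.lt_pow_succ_log_self (lt_of_lt_of_le one_lt_two two_le_B) n).le

/-- `Nx n ≤ B n` for `n ≥ 1`. [folklore] -/
theorem Nx_le {n : ℕ} (hn : 0 < n) : Nx n ≤ B * n := by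
  rw [Nx, N_eq, idx, pow_succ, mul_comm]
  exact Nat.mul_le_mul_left _ (Nat.pow_log_le_self B hn.ne')

/-- The degree `dX = (D D)³` of the cubes. [folklore] -/
def dX : ℕ := (D * D) ^ 3

/-- `dX > 0`. [folklore] -/
theorem dX_pos : 0 < dX := by unfold dX; have := D_pos; positivity

/-- **The expanders used to expanderize**: the cube of `G (log_B n)`, on `Nx n` vertices. [cite: AroraBarakCC2009, Claim 22.38 (the expander G_n on n vertices)] -/
def XN (n : ℕ) : RotGraph (Nx n) dX := (G (idx n)).power 3

/-- **`λ(XN n) ≤ 1/10`** (`(2/5)³ = 8/125`). [cite: AroraBarakCC2009, Claim 22.38 (λ(G_n) small)] -/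
theorem spectralBound_XN (n : ℕ) : SpectralBound (XN n).walkMatrix (1 / 10) := by
  have h := spectralBound_power (G (idx n)) (Nat.mul_pos D_pos D_pos) (spectralBound_G (idx n)) 3
  exact h.mono (by norm_num)

end Family

end Expander

end Literature.Computability.Complexity

end
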